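import Summits.ResolutionOfSingularities.ResolutionOfSingularities.Theorems.FrobeniusLadderFInjectiveMacaulayficationNonFullLoopFloorThree
import HarnessLib

/-!
# NEG-N, FLOOR 4 (chart step and the bad half of the locus lemma): `U₄ = Spec k[x,y,u,t,z]/(g₄)`, `g₄ = z² + x²z + x(y³+u³+t³)`;
# the `y`-chart of `Bl_𝔪 U₄` is `U₅ = U₀ = Spec k[X]/(g₅)`, `g₅ = z² + x²yz + xy²(u³+t³+1)` (the period-one loop germ); the origin of `U₄` is NOT FULL
# (crux `FInjectiveMacaulayfication` stmt-ResolutionOfSingularities-15315, chain w45a; res-L1-w45a-plan-1 g19 RULINGs R19.21 «NEG-N: an unconditional kernel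
# refutation of `Recipes.NonFullTowerConjecture` on the period-one bed d4lx6c3» / R19.22 (floor split: NEG-0, NEG-2, NEG-4 → stub-3); floor table =
# res-L1-w45a-tri-2 g16's replay (`k = 4: g₄, I₁ = (t,u,x,y,z), S₄ = 𝔪, Bl 𝔪 @y`); twin of res-L1-w45a-stub-1's ✓ `…NonFullLoopFloorOne` / `…NonFullLoopFloorThree`
# (same letters; `g₄` spelled as there, `g₅` spelled as in res-L1-w45a-lead-1's ✓ p645060 `…NonFullLoopFrame`); seat res-L1-w45a-stub-3 g10)

[OURS · L1 W4.5a] Support file (`--supports stmt-ResolutionOfSingularities-15315 --as helper`); replaces the role of NO printed item; NOT a statement of any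
manuscript; def-free (the floor polynomials are hypotheses `g₄ g₅` with their defining equations); UNCONDITIONAL; `CharP k 2` where primality of `g₄` is used
(it comes from `…NonFullLoopFloorThree.isPrime_span_g₄`, which needs `2 = 0`). AI-written (AI review is weaker than expert review).

`X 0 = x`, `X 1 = y`, `X 2 = u`, `X 3 = t`, `X 4 = z`.
* §1 ★ `theta_y` — the chart identity `g₄(xy, y, uy, ty, zy) = y²·g₅` (`ring`); `g₄_not_mem_span_X1`, `g₅_not_mem_span_X1` (evaluate at `e_z`), `g_ne_zero`,
  `isPrime_span_g₅` (prime transfer along `θ_y` from `(g₄)`, `PrimeTransfer.stub_primeTransfer`; `(g₄)` prime by stub-1's floor-3 file);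
* §2 ★★ `exists_chartEquiv_y` — `k[X]/(g₅) ≃+*` the Rees chart `D(ȳt)` of `Bl_𝔪 U₄` (`𝔪 = (x̄,ȳ,ū,t̄,z̄)` the origin of `U₄`), sending `ȳ ↦ ȳ/1`
  (`StrictTransformChartN.stub_strictTransformChartN`): THE FLOOR-4 → FLOOR-5 LINK of the N-tower (`U₅ = U₀` is an open of `Bl_{S₄} U₄`, `S₄ = 𝔪`);
  `cmCl_localization` (hypersurfaces are CM);
* §3 ★★ `g₄_mem_bracket` (`g₄ = z·z + x²·z + y²·xy + u²·xu + t²·xt ∈ 𝔪^{[2]}`), `constantCoeff_g₄`, `isMaximal_origin`, ★★ `origin_not_fullCl` —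
  THE ORIGIN OF `U₄` IS NOT FULL (Fedder necessity, `HypersurfaceOriginNotFull.not_fullCl_stalk_origin_of_fedder_mem`): the «⊇» half of the floor-4 locus
  lemma «nonFull(U₄) = V(𝔪)»; `origin_not_fullCl_localization`, `not_fullCl_of_origin_le`. The «⊆» half (FULL off the origin: root coefficients
  `x | y | u | t | z` on `D(x), D(y), D(u), D(t), D(z)`) is the sequel file.
[cite: GortzWedhorn2020, (13.19)] [cite: Fedder1983, Prop. 1.7] [cite: Matsumura1987, Thm. 17.4]
-/

-- single-problem summit: the doubled namespace component is forced
set_option linter.dupNamespace false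

noncomputable section

open AlgebraicGeometry CategoryTheory Literature.AlgebraicGeometry.Resolution TopologicalSpace IsLocalRing MvPolynomial

namespace Summit.ResolutionOfSingularities.ResolutionOfSingularities.Theorems.FInjectiveMacaulayfication.NonFullLoopFloorFour

open Summit.ResolutionOfSingularities.ResolutionOfSingularities.Theorems.FInjectiveMacaulayfication
open SliceableCentre GermForm GermOfGlobalBlowup

variable (k : Type) [Field k]

/-! ## §1 The chart identity, primality -/

/-- ★ **THE CHART IDENTITY OF FLOOR 4**: `g₄(xy, y, uy, ty, zy) = y²·g₅` — the `y`-chart of the blow-up of `U₄` at its origin has strict transform `g₅`,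
the period-one loop germ. [folklore] -/
theorem theta_y (g₄ : MvPolynomial (Fin 5) k) (hg₄ : g₄ = X 4 ^ 2 + X 0 ^ 2 * X 4 + X 0 * X 1 ^ 3 + X 0 * X 2 ^ 3 + X 0 * X 3 ^ 3)
    (g₅ : MvPolynomial (Fin 5) k) (hg₅ : g₅ = X 4 ^ 2 + X 0 ^ 2 * X 1 * X 4 + X 0 * X 1 ^ 2 * X 2 ^ 3 + X 0 * X 1 ^ 2 * X 3 ^ 3 + X 0 * X 1 ^ 2) :
    aeval (fun j : Fin 5 => if j = 1 then (X 1 : MvPolynomial (Fin 5) k) else X j * X 1) g₄ = X 1 ^ 2 * g₅ := by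
  subst hg₄; subst hg₅
  simp
  ring

/-- `g₄ ∉ (y)`: at `e_z` (`z = 1`, others `0`) `g₄ = 1`. [folklore] -/
theorem g₄_not_mem_span_X1 (g₄ : MvPolynomial (Fin 5) k) (hg₄ : g₄ = X 4 ^ 2 + X 0 ^ 2 * X 4 + X 0 * X 1 ^ 3 + X 0 * X 2 ^ 3 + X 0 * X 3 ^ 3) :
    g₄ ∉ Ideal.span {(X 1 : MvPolynomial (Fin 5) k)} := by
  intro h
  rw [Ideal.mem_span_singleton] at h
  obtain ⟨c, hc⟩ := h
  have := congrArg (MvPolynomial.eval (Pi.single 4 1 : Fin 5 → k)) hc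
  rw [hg₄] at this
  simp at this

/-- `g₅ ∉ (y)`: at `e_z` `g₅ = 1`. [folklore] -/
theorem g₅_not_mem_span_X1 (g₅ : MvPolynomial (Fin 5) k) (hg₅ : g₅ = X 4 ^ 2 + X 0 ^ 2 * X 1 * X 4 + X 0 * X 1 ^ 2 * X 2 ^ 3 + X 0 * X 1 ^ 2 * X 3 ^ 3 + X 0 * X 1 ^ 2) :
    g₅ ∉ Ideal.span {(X 1 : MvPolynomial (Fin 5) k)} := by
  intro h
  rw [Ideal.mem_span_singleton] at h
  obtain ⟨c, hc⟩ := h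
  have := congrArg (MvPolynomial.eval (Pi.single 4 1 : Fin 5 → k)) hc
  rw [hg₅] at this
  simp at this

/-- `g₄ ≠ 0`, `g₅ ≠ 0`. [plumbing] -/
theorem g_ne_zero (g₄ : MvPolynomial (Fin 5) k) (hg₄ : g₄ = X 4 ^ 2 + X 0 ^ 2 * X 4 + X 0 * X 1 ^ 3 + X 0 * X 2 ^ 3 + X 0 * X 3 ^ 3)
    (g₅ : MvPolynomial (Fin 5) k) (hg₅ : g₅ = X 4 ^ 2 + X 0 ^ 2 * X 1 * X 4 + X 0 * X 1 ^ 2 * X 2 ^ 3 + X 0 * X 1 ^ 2 * X 3 ^ 3 + X 0 * X 1 ^ 2) : g₄ ≠ 0 ∧ g₅ ≠ 0 :=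
  ⟨fun h => g₄_not_mem_span_X1 k g₄ hg₄ (h ▸ Ideal.zero_mem _), fun h => g₅_not_mem_span_X1 k g₅ hg₅ (h ▸ Ideal.zero_mem _)⟩

/-- **`(g₄)` and `(g₅)` are prime**: `(g₄)` by res-L1-w45a-stub-1's floor-3 file, `(g₅)` by prime transfer along `θ_y`. [folklore; `PrimeTransfer.stub_primeTransfer`] -/
theorem isPrime_span_g₅ [CharP k 2] (g₄ : MvPolynomial (Fin 5) k) (hg₄ : g₄ = X 4 ^ 2 + X 0 ^ 2 * X 4 + X 0 * X 1 ^ 3 + X 0 * X 2 ^ 3 + X 0 * X 3 ^ 3)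
    (g₅ : MvPolynomial (Fin 5) k) (hg₅ : g₅ = X 4 ^ 2 + X 0 ^ 2 * X 1 * X 4 + X 0 * X 1 ^ 2 * X 2 ^ 3 + X 0 * X 1 ^ 2 * X 3 ^ 3 + X 0 * X 1 ^ 2) :
    (Ideal.span {g₄}).IsPrime ∧ (Ideal.span {g₅}).IsPrime := by
  have h1 : (Ideal.span {g₄}).IsPrime := (NonFullLoopFloorThree.isPrime_span_g₄ k _ rfl g₄ hg₄).2
  exact ⟨h1, (PrimeTransfer.stub_primeTransfer k 5 1 g₄ g₅ 2 (theta_y k g₄ hg₄ g₅ hg₅) (g₄_not_mem_span_X1 k g₄ hg₄) (g₅_not_mem_span_X1 k g₅ hg₅)).mp h1⟩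

/-! ## §2 The floor-4 → floor-5 link: `k[X]/(g₅)` is the `y`-chart of `Bl_𝔪 U₄`; CM -/

set_option maxHeartbeats 800000 in
-- chart-ring types are expensive to unify (as in `StrictTransformChartN`)
/-- ★★ **`U₅ = U₀ = Spec k[X]/(g₅)` IS THE REES CHART `D(ȳt)` OF THE BLOW-UP OF `U₄` AT ITS ORIGIN**: a ring isomorphism onto
`(A₄[𝔪t])_{(ȳt)}`, `A₄ = k[X]/(g₄)`, `𝔪 = (x̄, ȳ, ū, t̄, z̄)`, sending `ȳ ↦ ȳ/1`. [folklore; `StrictTransformChartN.stub_strictTransformChartN`; cite: GortzWedhorn2020, (13.19)] -/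
theorem exists_chartEquiv_y [CharP k 2] (g₄ : MvPolynomial (Fin 5) k) (hg₄ : g₄ = X 4 ^ 2 + X 0 ^ 2 * X 4 + X 0 * X 1 ^ 3 + X 0 * X 2 ^ 3 + X 0 * X 3 ^ 3)
    (g₅ : MvPolynomial (Fin 5) k) (hg₅ : g₅ = X 4 ^ 2 + X 0 ^ 2 * X 1 * X 4 + X 0 * X 1 ^ 2 * X 2 ^ 3 + X 0 * X 1 ^ 2 * X 3 ^ 3 + X 0 * X 1 ^ 2) :
    ∃ e : (MvPolynomial (Fin 5) k ⧸ Ideal.span {g₅}) ≃+*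
        HomogeneousLocalization.Away (reesGrading (Ideal.span (Set.range (fun j : Fin 5 => Ideal.Quotient.mk (Ideal.span {g₄}) (X j)))))
          (reesT ((fun j : Fin 5 => Ideal.Quotient.mk (Ideal.span {g₄}) (X j)) 1) (Ideal.subset_span (Set.mem_range_self 1))),
      e (Ideal.Quotient.mk (Ideal.span {g₅}) (X 1)) =
        reesChartBase ((fun j : Fin 5 => Ideal.Quotient.mk (Ideal.span {g₄}) (X j)) 1) (Ideal.subset_span (Set.mem_range_self 1))
          ((fun j : Fin 5 => Ideal.Quotient.mk (Ideal.span {g₄}) (X j)) 1) := by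
  obtain ⟨h1, h2⟩ := isPrime_span_g₅ k g₄ hg₄ g₅ hg₅
  exact StrictTransformChartN.stub_strictTransformChartN k 5 g₄ g₅ 1 2 h1 (g_ne_zero k g₄ hg₄ g₅ hg₅).1 h2
    (PrimeTransfer.X_not_mem_span_of_isPrime h2 (g₅_not_mem_span_X1 k g₅ hg₅)) (theta_y k g₄ hg₄ g₅ hg₅) _ rfl

/-- The CM clause at every prime of `U₄` and of `U₅` (hypersurfaces in a regular ring). [cite: Matsumura1987, Thm. 17.4 (iii), Thm. 17.8] -/
theorem cmCl_localization (g₄ : MvPolynomial (Fin 5) k) (hg₄ : g₄ = X 4 ^ 2 + X 0 ^ 2 * X 4 + X 0 * X 1 ^ 3 + X 0 * X 2 ^ 3 + X 0 * X 3 ^ 3)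
    (g₅ : MvPolynomial (Fin 5) k) (hg₅ : g₅ = X 4 ^ 2 + X 0 ^ 2 * X 1 * X 4 + X 0 * X 1 ^ 2 * X 2 ^ 3 + X 0 * X 1 ^ 2 * X 3 ^ 3 + X 0 * X 1 ^ 2) :
    (∀ Q : Spec (.of (MvPolynomial (Fin 5) k ⧸ Ideal.span {g₄})), CMCl (Localization.AtPrime Q.asIdeal)) ∧
    (∀ Q : Spec (.of (MvPolynomial (Fin 5) k ⧸ Ideal.span {g₅})), CMCl (Localization.AtPrime Q.asIdeal)) :=
  ⟨fun Q => DoublePointFermatCubicGerm.cmCl_localization_hypersurface k g₄ (g_ne_zero k g₄ hg₄ g₅ hg₅).1 Q,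
    fun Q => DoublePointFermatCubicGerm.cmCl_localization_hypersurface k g₅ (g_ne_zero k g₄ hg₄ g₅ hg₅).2 Q⟩

/-! ## §3 The origin of `U₄` is NOT FULL (the «⊇» half of the floor-4 locus lemma) -/

/-- ★★ `g₄ ∈ 𝔪^{[2]} = (x², y², u², t², z²)`: `g₄ = z·z + x²·z + y²·xy + u²·xu + t²·xt`. [certificate; cite: Fedder1983, Prop. 1.7] -/
theorem g₄_mem_bracket (g₄ : MvPolynomial (Fin 5) k) (hg₄ : g₄ = X 4 ^ 2 + X 0 ^ 2 * X 4 + X 0 * X 1 ^ 3 + X 0 * X 2 ^ 3 + X 0 * X 3 ^ 3) :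
    g₄ ^ (2 - 1) ∈ Ideal.span (Set.range fun i : Fin 5 => (X i : MvPolynomial (Fin 5) k) ^ 2) := by
  rw [show (2 - 1 : ℕ) = 1 from rfl, pow_one, hg₄]
  have hsq : ∀ j : Fin 5, (X j : MvPolynomial (Fin 5) k) ^ 2 ∈ Ideal.span (Set.range fun i : Fin 5 => (X i : MvPolynomial (Fin 5) k) ^ 2) :=
    fun j => Ideal.subset_span ⟨j, rfl⟩
  refine Ideal.add_mem _ (Ideal.add_mem _ (Ideal.add_mem _ (Ideal.add_mem _ (hsq 4) ?_) ?_) ?_) ?_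
  · exact Ideal.mul_mem_right _ _ (hsq 0)
  all_goals
    rw [show ∀ j : Fin 5, (X 0 : MvPolynomial (Fin 5) k) * X j ^ 3 = X j ^ 2 * (X 0 * X j) from fun j => by ring]
    exact Ideal.mul_mem_right _ _ (hsq _)

/-- `g₄` has no constant term. [plumbing] -/
theorem constantCoeff_g₄ (g₄ : MvPolynomial (Fin 5) k) (hg₄ : g₄ = X 4 ^ 2 + X 0 ^ 2 * X 4 + X 0 * X 1 ^ 3 + X 0 * X 2 ^ 3 + X 0 * X 3 ^ 3) :
    constantCoeff g₄ = 0 := by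
  rw [hg₄]; simp [constantCoeff_X]

/-- The origin `(x̄, ȳ, ū, t̄, z̄)` of `U₄` is a maximal ideal. [folklore] -/
theorem isMaximal_origin (g₄ : MvPolynomial (Fin 5) k) (hg₄ : g₄ = X 4 ^ 2 + X 0 ^ 2 * X 4 + X 0 * X 1 ^ 3 + X 0 * X 2 ^ 3 + X 0 * X 3 ^ 3) :
    (Ideal.span (Set.range fun j : Fin 5 => Ideal.Quotient.mk (Ideal.span {g₄}) (X j))).IsMaximal :=
  DoublePointFermatCubicGerm.isMaximal_origin k g₄ (constantCoeff_g₄ k g₄ hg₄)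

/-- ★★ **THE ORIGIN OF `U₄` IS NOT FULL** (stalk form): Fedder necessity `g₄ ∈ 𝔪^{[2]}`. [OURS · certificate; cite: Fedder1983, Prop. 1.7] -/
theorem origin_not_fullCl [CharP k 2] (g₄ : MvPolynomial (Fin 5) k) (hg₄ : g₄ = X 4 ^ 2 + X 0 ^ 2 * X 4 + X 0 * X 1 ^ 3 + X 0 * X 2 ^ 3 + X 0 * X 3 ^ 3)
    (v : Spec (.of (MvPolynomial (Fin 5) k ⧸ Ideal.span {g₄})))
    (hv : v.asIdeal = Ideal.span (Set.range fun j : Fin 5 => Ideal.Quotient.mk (Ideal.span {g₄}) (X j))) :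
    ¬ FullCl 2 ((Spec (.of (MvPolynomial (Fin 5) k ⧸ Ideal.span {g₄}))).presheaf.stalk v) := by
  haveI : Fact (Nat.Prime 2) := ⟨Nat.prime_two⟩
  exact HypersurfaceOriginNotFull.not_fullCl_stalk_origin_of_fedder_mem 2 k g₄ (fun h => g₄_not_mem_span_X1 k g₄ hg₄ (h ▸ Ideal.zero_mem _))
    (constantCoeff_g₄ k g₄ hg₄) (g₄_mem_bracket k g₄ hg₄) v hv

/-- ★★ **THE ORIGIN OF `U₄` IS NOT FULL** (localization form). [OURS · certificate] -/
theorem origin_not_fullCl_localization [CharP k 2] (g₄ : MvPolynomial (Fin 5) k) (hg₄ : g₄ = X 4 ^ 2 + X 0 ^ 2 * X 4 + X 0 * X 1 ^ 3 + X 0 * X 2 ^ 3 + X 0 * X 3 ^ 3)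
    (P : Ideal (MvPolynomial (Fin 5) k ⧸ Ideal.span {g₄})) [hP : P.IsPrime]
    (hPv : P = Ideal.span (Set.range fun j : Fin 5 => Ideal.Quotient.mk (Ideal.span {g₄}) (X j))) : ¬ FullCl 2 (Localization.AtPrime P) := by
  intro hfull
  let v : Spec (.of (MvPolynomial (Fin 5) k ⧸ Ideal.span {g₄})) := ⟨P, hP⟩
  exact origin_not_fullCl k g₄ hg₄ v hPv (WFixAtNonClosedDimTwo.fullCl_of_ringEquiv 2 (Spec.stalkIso (.of _) v).commRingCatIsoToRingEquiv.symm hfull)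

/-- The «⊇» half of the floor-4 locus lemma: every point of `V(𝔪) ⊂ U₄` (i.e. the origin) is NON-FULL. [OURS · certificate] -/
theorem not_fullCl_of_origin_le [CharP k 2] (g₄ : MvPolynomial (Fin 5) k) (hg₄ : g₄ = X 4 ^ 2 + X 0 ^ 2 * X 4 + X 0 * X 1 ^ 3 + X 0 * X 2 ^ 3 + X 0 * X 3 ^ 3)
    (s : Spec (.of (MvPolynomial (Fin 5) k ⧸ Ideal.span {g₄})))
    (hs : Ideal.span (Set.range fun j : Fin 5 => Ideal.Quotient.mk (Ideal.span {g₄}) (X j)) ≤ s.asIdeal) :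
    ¬ FullCl 2 ((Spec (.of (MvPolynomial (Fin 5) k ⧸ Ideal.span {g₄}))).presheaf.stalk s) :=
  origin_not_fullCl k g₄ hg₄ s ((isMaximal_origin k g₄ hg₄).eq_of_le s.2.ne_top hs).symm

end Summit.ResolutionOfSingularities.ResolutionOfSingularities.Theorems.FInjectiveMacaulayfication.NonFullLoopFloorFour

end
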